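import Literature.AlgebraicGeometry.Resolution.MarkedIdealsLemmas
import Literature.AlgebraicGeometry.Resolution.MarkedResolutions
import Literature.AlgebraicGeometry.Resolution.BlowupsFlatBaseChange
import Literature.AlgebraicGeometry.Resolution.EtaleLocalAlgebra
import Literature.AlgebraicGeometry.Resolution.ResolutionGlue
import Mathlib.AlgebraicGeometry.Morphisms.Etale
import Mathlib.RingTheory.Flat.Basic
import HarnessLib

/-!
# Marked ideals under étale morphisms and flat base change (BGMW 2011, Thm. 8.0.5 / Lemma 8.0.3 (2))

Topic: `Literature/AlgebraicGeometry/Resolution`. Bierstone–Grigoriev–Milman–Włodarczyk,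
*Effective Hironaka resolution and its complexity (with appendix on applications in positive
characteristic)*, arXiv:1206.3090 (= Asian J. Math. 15 (2011) 193–228), §8 (p. 23, arXiv
numbering). The canonical resolution of marked ideals (Thm. 4.0.6 in characteristic zero,
Thm. 8.0.5 in characteristic `p > M̄`) is functorial for étale morphisms:

  **Theorem 8.0.5.** "… (1) For any surjective étale morphism `φ : X' → X`, the induced
  sequence `(X'_i) = φ^*(X_i)` is the canonical resolution of
  `(X', 𝓘', E', μ) := φ^*(X, 𝓘, E, μ)`. (2) For any étale morphism `φ : M' → M`, the induced
  sequence `(X'_i) = φ^*(X_i)` is an extension of the canonical resolution of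
  `(X', 𝓘', E', μ) := φ^*(X, 𝓘, E, μ)`."

and the multiplicity bound of the appendix is étale-local:

  **Lemma 8.0.3 (2).** "If `(X', 𝓘', E', x') → (X, 𝓘, E, x)` is étale then
  `M̄(X, 𝓘, E, μ, x) = M̄(X', 𝓘', E', μ, x')`" — "Proof. Follows from the definition. We use here
  also the canonicity of Hironaka resolution and the fact that étale morphisms preserve
  multiplicities."

Both presuppose that the data of a marked ideal and of its transforms (BGMW Def. 3.1.1–3.1.3:
the order `ord_x(𝓘)`, the support `supp(𝓘, μ) = {x | ord_x(𝓘) ≥ μ}`, the controlled transform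
`σᶜ(𝓘, μ) = 𝓘(D)^{-μ} σ^*𝓘`, the strict transforms of the boundary divisors, the regularity
[printed: smoothness] of the centres) are compatible with pulling back along an étale `φ` and
along the induced (flat) morphisms `φ_i : X'_i → X_i` of the blown-up schemes. This file PROVES
these compatibilities over Mathlib and the tree, for the vocabulary of `MarkedIdeals.lean`
(`stalkIdeal`, `idealOrder`, `MarkedIdeal.support`, `colon`, `controlledTransform`,
`strictTransformIdeal`, `MarkedIdeal.transform`) and Mathlib's `Etale` / `Flat` /
`FormallyUnramified` morphism classes. The pulled-back marked ideal `φ^*(X, 𝓘, E, μ)` is written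
as the structure `⟨𝓘.comap φ, E.map (·.comap φ), μ⟩` (no new definition is introduced, so the
statements apply verbatim to any packaging of `φ^*` as a `MarkedIdeal`).

## Content (all PROVED)

* `Ideal.colon_singleton_map_le_of_flat`, `Ideal.map_colon_of_flat` — **colon ideals commute with
  flat base change when the second argument is finitely generated** (Matsumura, Thm. 7.4 (iii):
  "if `B` is flat over `A` … `(I :_A J)B = (IB :_B JB)` if `J` is finitely generated"), by
  tensoring the exact sequence `0 → (L : a) → A → A/L` with the flat `B`.
* `stalkIdeal_comap_eq_map` — the stalk of `𝓘.comap φ` at `x'` is `𝓘_{φ x'} · 𝒪_{X', x'}`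
  (any morphism `φ`); `stalkIdeal_map_le_pow_of_le_pow`, `preimage_support_subset` —
  `φ⁻¹ supp(𝓘, μ) ⊆ supp(φ^*𝓘, μ)` for ANY morphism.
* For `φ` flat, formally unramified and locally of finite type (e.g. `Etale φ`):
  `map_stalkMap_le_maximalIdeal_pow_iff` (the stalk maps are étale local homomorphisms, which
  preserve `𝔪`-adic orders: `EtaleLocalAlgebra.lean`), **`le_idealOrder_comap_iff`,
  `idealOrder_comap_of_etale` — "étale morphisms preserve multiplicities":
  `ord_{x'}(φ^*𝓘) = ord_{φ x'}(𝓘)`**, and **`MarkedIdeal.support_comap_of_etale` —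
  `supp(φ^*(𝓘, μ)) = φ⁻¹ supp(𝓘, μ)`**.
* `comap_colon_of_flat` — `(L : M).comap t = (L.comap t : M.comap t)` for `t` flat between
  locally Noetherian schemes; hence, for a commutative square `t ≫ π = π' ≫ φ` with `t` flat
  (e.g. the cartesian square of blow-ups `Bl_{φ^*C} X' → Bl_C X` over an étale or flat `φ`,
  `BlowupsFlatBaseChange.lean`): **`comap_controlledTransform_of_flat`**
  (`t^* σᶜ(𝓘, μ) = σ'ᶜ(φ^*𝓘, μ)` with respect to the centre `φ^*C`),
  **`comap_strictTransformIdeal_of_flat`**, and **`MarkedIdeal.transform_comap_of_flat`** — the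
  transform (BGMW Def. 3.1.3 (3)–(5)) of the pulled-back marked ideal is the pull-back of the
  transform: `(φ^*(X, 𝓘, E, μ))' = t^*((X, 𝓘, E, μ)')`.
* `isRegularLocalRing_stalk_iff_of_etale`, `Scheme.IsRegular.of_flat_of_formallyUnramified`,
  **`Scheme.IsRegular.subscheme_comap_of_etale`** — regularity of the centres `V(C)` is preserved:
  `V(φ^*C) = V(C) ×_X X'` is étale over `V(C)` (étale local homomorphisms of Noetherian local
  rings preserve and reflect regularity, Matsumura 23.7; `EtaleLocalAlgebra.lean`).
* `map_stalkMap_maximalIdeal` (`𝔪_{φ x'} 𝒪_{X',x'} = 𝔪_{x'}`), `ringKrullDim_stalk_eq_of_etale`,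
  **`HasSNCWith.comap_of_etale`** — the simple-normal-crossings conditions on the boundary and
  the centre (BGMW Def. 3.1.1, Def. 3.1.3 (2)) pull back: a regular system of parameters of
  `𝒪_{X,φ x'}` adapted to `E` and `C` maps to one of `𝒪_{X',x'}` adapted to `φ^*E` and `φ^*C`.
* **`IsMultipleBlowup.exists_isPullback_of_etale`, `IsMarkedResolution.exists_isPullback_of_etale`**
  — the assembly along a whole multiple blow-up (BGMW Def. 3.1.3, `IsMultipleBlowup` /
  `IsMarkedResolution` of `MarkedIdeals.lean`): **the fibre product `Z ×_X X' → X'` of a multiple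
  blow-up (resp. resolution) `Z → X` of `(X, 𝓘, E, μ)` with an étale `φ : X' → X` is a multiple
  blow-up (resp. resolution) of `φ^*(X, 𝓘, E, μ)`**, with final marked ideal the pull-back of
  the final marked ideal — the content of "the induced sequence `φ^*(X_i)`" in Thm. 8.0.5.

The data-level counterpart (pulling back the individual centres of a `CentreSeq` of
`BlowupSequences.lean`, extensions in the sense of Def. 3.1.5) is not treated here; the
one-step statements above are phrased for an arbitrary commutative / cartesian square so as to
apply to any such packaging.

## Sources

* [BGMW 2011] E. Bierstone, D. Grigoriev, P. Milman, J. Włodarczyk, arXiv:1206.3090, §3.1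
  Defs. 3.1.1–3.1.3, §3.2; §8 Lemma 8.0.3, Thm. 8.0.5 (p. 23). [BierstoneGrigorievMilmanWlodarczyk2011]
* H. Matsumura, *Commutative Ring Theory*, CUP 1986, Thm. 7.4 (iii) (flat base change of colon
  ideals), Thm. 23.7 (regularity along flat local homomorphisms). [Matsumura1987]
* The Stacks Project, Tag 00UW (unramified local algebras: `𝔪_A B = 𝔪_B`). [StacksProject]
-/

noncomputable section

open CategoryTheory CategoryTheory.Limits AlgebraicGeometry TopologicalSpace IsLocalRing
open scoped TensorProduct

namespace Literature.AlgebraicGeometry.Resolution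

universe u

/-! ## Colon ideals commute with flat base change (Matsumura Thm. 7.4 (iii)) -/

section FlatColon

variable {A B : Type*} [CommRing A] [CommRing B] [Algebra A B]

/-- **Principal case of Matsumura Thm. 7.4 (iii)**: for `B` flat over `A`, an ideal `L ⊆ A` and
`a ∈ A`, `(LB : a) ⊆ (L : a)B` (the reverse inclusion being formal). Proof: `(L : a)` is the
kernel of `A → A/L, r ↦ ra`; tensoring `0 → (L : a) → A → A/L` with the flat `B` keeps it exact,
and `B ⊗ A/L = B/LB`. [cite: Matsumura1987, Thm. 7.4 (iii)] -/
theorem Ideal.colon_singleton_map_le_of_flat [Module.Flat A B] (L : Ideal A) (a : A) :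
    (L.map (algebraMap A B)).colon {algebraMap A B a} ≤ (L.colon {a}).map (algebraMap A B) := by
  intro x hx
  rw [Submodule.mem_colon_singleton, smul_eq_mul] at hx
  -- `ψ : A → A/L`, `r ↦ [r a]`, with kernel `(L : a)`
  let ψ : A →ₗ[A] (A ⧸ L) := (Submodule.mkQ L).comp (LinearMap.mulRight A a)
  have hψ : ∀ r : A, ψ r = Submodule.Quotient.mk (r * a) := fun r => rfl
  have hker : LinearMap.ker ψ = L.colon {a} := by
    ext r
    rw [LinearMap.mem_ker, Submodule.mem_colon_singleton, hψ, Submodule.Quotient.mk_eq_zero,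
      smul_eq_mul]
  have hexB := Module.Flat.lTensor_exact B (LinearMap.exact_subtype_ker_map ψ)
  -- `x ⊗ 1 ↦ x ⊗ [a] = (a x) ⊗ [1] = 0` in `B ⊗ A/L ≅ B/LB`
  let e := (Algebra.TensorProduct.quotIdealMapEquivTensorQuot B L).toLinearEquiv
  have h0 : (ψ.lTensor B) (x ⊗ₜ[A] (1 : A)) = 0 := by
    rw [LinearMap.lTensor_tmul, hψ, one_mul]
    have e1 : (Submodule.Quotient.mk a : A ⧸ L) = a • Submodule.Quotient.mk (1 : A) := by
      rw [← Submodule.Quotient.mk_smul, smul_eq_mul, mul_one]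
    rw [e1, ← TensorProduct.smul_tmul]
    have e2 : e (Ideal.Quotient.mk _ (a • x)) = (a • x) ⊗ₜ[A] Submodule.Quotient.mk (1 : A) := rfl
    have hax : a • x ∈ L.map (algebraMap A B) := by
      rw [Algebra.smul_def, mul_comm]
      exact hx
    rw [← e2, Ideal.Quotient.eq_zero_iff_mem.mpr hax, map_zero]
  obtain ⟨z, hz⟩ := (hexB _).mp h0
  -- `x = rid (x ⊗ 1)` lies in the image `(L : a) B` of `B ⊗ (L : a)`
  have hx' : x = TensorProduct.rid A B (((LinearMap.ker ψ).subtype.lTensor B) z) := by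
    rw [hz, TensorProduct.rid_tmul, one_smul]
  rw [hx', ← hker]
  clear hx' hz
  induction z using TensorProduct.induction_on with
  | zero =>
    rw [map_zero, map_zero]
    exact zero_mem _
  | tmul b k =>
    rw [LinearMap.lTensor_tmul, TensorProduct.rid_tmul, Submodule.subtype_apply, Algebra.smul_def]
    exact Ideal.mul_mem_right _ _ (Ideal.mem_map_of_mem _ k.2)
  | add z w hz hw =>
    rw [map_add, map_add]
    exact add_mem hz hw

/-- **Colon ideals commute with flat base change when the second argument is finitely
generated** (Matsumura, Thm. 7.4 (iii)): `(L : M) B = (LB : MB)` for `B` flat over `A` and `M`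
finitely generated — reduce to the generators of `M` (`(L : M) = ⋂ (L : mᵢ)`, and extension
along a flat algebra commutes with finite intersections, `Ideal.map_finset_inf_of_flat`) and the
principal case `Ideal.colon_singleton_map_le_of_flat`. [cite: Matsumura1987, Thm. 7.4 (iii)] -/
theorem Ideal.map_colon_of_flat [Module.Flat A B] (L M : Ideal A) (hM : M.FG) :
    (L.colon (M : Set A)).map (algebraMap A B) =
      (L.map (algebraMap A B)).colon (M.map (algebraMap A B) : Set B) := by
  classical
  apply le_antisymm
  · -- `(L : M) B ⊆ (LB : MB)` (formal)
    rw [Ideal.map_le_iff_le_comap]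
    intro r hr
    rw [Ideal.mem_comap]
    change algebraMap A B r ∈ (L.map (algebraMap A B)).colon
      (Ideal.span (algebraMap A B '' (M : Set A)) : Set B)
    rw [Ideal.colon_span, Submodule.mem_colon]
    rintro _ ⟨m, hm, rfl⟩
    rw [smul_eq_mul, ← map_mul]
    exact Ideal.mem_map_of_mem _ (Submodule.mem_colon.mp hr m hm)
  · -- `(LB : MB) ⊆ (L : M) B`: generator by generator
    obtain ⟨F, rfl⟩ := hM
    intro x hx
    have hF : L.colon (Ideal.span (F : Set A) : Set A) = F.inf fun m => L.colon {m} := by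
      ext r
      rw [Ideal.colon_span, Submodule.mem_colon, Submodule.mem_finsetInf]
      refine ⟨fun h m hm => Submodule.mem_colon_singleton.mpr (h m hm), fun h m hm => ?_⟩
      exact Submodule.mem_colon_singleton.mp (h m hm)
    rw [hF, Ideal.map_finset_inf_of_flat, Submodule.mem_finsetInf]
    intro m hm
    refine Ideal.colon_singleton_map_le_of_flat L m (Submodule.mem_colon_singleton.mpr ?_)
    refine Submodule.mem_colon.mp hx _ ?_
    exact Ideal.mem_map_of_mem _ (Ideal.subset_span hm)

end FlatColon

/-! ## Stalks, orders and supports of pulled-back ideal sheaves -/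

section Stalk

variable {X' X : Scheme.{u}} (φ : X' ⟶ X)

/-- **The stalk of a pulled-back ideal sheaf**: `(𝓘.comap φ)_{x'} = 𝓘_{φ x'} · 𝒪_{X', x'}` for an
arbitrary morphism `φ` (chart formula `ideal_comap_of_le` on affine opens `V ⊆ φ⁻¹ U` and
`germ ∘ φ^* = φ^*_{x'} ∘ germ`; the affine-morphism case is `stalkIdeal_comap`). [folklore] -/
theorem stalkIdeal_comap_eq_map (I : X.IdealSheafData) (x' : X') :
    stalkIdeal (I.comap φ) x' = (stalkIdeal I (φ x')).map (φ.stalkMap x').hom := by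
  obtain ⟨U, hU, hxU, -⟩ :=
    exists_isAffineOpen_mem_and_subset (X := X) (x := φ x') (U := ⊤) (Opens.mem_top _)
  obtain ⟨V, hV, hxV, hVU⟩ :=
    exists_isAffineOpen_mem_and_subset (X := X') (x := x') (U := φ ⁻¹ᵁ U) hxU
  rw [stalkIdeal_eq_map_germ (I.comap φ) ⟨V, hV⟩ hxV, stalkIdeal_eq_map_germ I ⟨U, hU⟩ hxU,
    ideal_comap_of_le φ I ⟨U, hU⟩ ⟨V, hV⟩ hVU, Ideal.map_map, Ideal.map_map]
  congr 1
  rw [← CommRingCat.hom_comp, ← CommRingCat.hom_comp, Scheme.Hom.germ_stalkMap φ U x' hxU,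
    Scheme.Hom.appLE, Category.assoc]
  erw [X'.presheaf.germ_res (homOfLE hVU) x' hxV]

/-- Along any local homomorphism, `I ⊆ 𝔪^n` implies `I · 𝒪' ⊆ 𝔪'^n`; for stalk maps of a morphism
of schemes: `𝓘_{φ x'} ⊆ 𝔪_{φ x'}^n ⟹ (φ^*𝓘)_{x'} ⊆ 𝔪_{x'}^n`. [folklore] -/
theorem stalkIdeal_map_le_pow_of_le_pow {I : X.IdealSheafData} {x' : X'} {n : ℕ}
    (h : stalkIdeal I (φ x') ≤ maximalIdeal (X.presheaf.stalk (φ x')) ^ n) :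
    stalkIdeal (I.comap φ) x' ≤ maximalIdeal (X'.presheaf.stalk x') ^ n := by
  rw [stalkIdeal_comap_eq_map]
  refine (Ideal.map_mono h).trans ?_
  rw [Ideal.map_pow]
  refine Ideal.pow_right_mono ?_ n
  exact ((IsLocalRing.local_hom_TFAE (φ.stalkMap x').hom).out 0 2 rfl rfl).mp inferInstance

/-- `ord_{φ x'}(𝓘) ≤ ord_{x'}(φ^*𝓘)` for any morphism `φ`. [folklore] -/
theorem idealOrder_le_idealOrder_comap (I : X.IdealSheafData) (x' : X') :
    idealOrder I (φ x') ≤ idealOrder (I.comap φ) x' := by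
  refine ENat.forall_natCast_le_iff_le.mp fun n hn => ?_
  rw [le_idealOrder_iff] at hn ⊢
  exact stalkIdeal_map_le_pow_of_le_pow φ hn

/-- **`φ⁻¹ supp(𝓘, μ) ⊆ supp(φ^*𝓘, μ)` for any morphism `φ`** (the support of the pulled-back
marked ideal `φ^*(X, 𝓘, E, μ) = (X', φ^*𝓘, φ^*E, μ)` contains the preimage of the support).
[cite: BierstoneGrigorievMilmanWlodarczyk2011, Def. 3.1.2 with Thm. 8.0.5] -/
theorem MarkedIdeal.preimage_support_subset (M : MarkedIdeal X) (E' : List X'.IdealSheafData) :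
    φ ⁻¹' M.support ⊆ (⟨M.ideal.comap φ, E', M.mult⟩ : MarkedIdeal X').support := by
  intro x' hx'
  change (M.mult : ℕ∞) ≤ idealOrder (M.ideal.comap φ) x'
  exact le_trans hx' (idealOrder_le_idealOrder_comap φ M.ideal x')

end Stalk

/-! ## Étale morphisms preserve multiplicities (BGMW Lemma 8.0.3 (2)) -/

section Etale

variable {X' X : Scheme.{u}} (φ : X' ⟶ X) [Flat φ] [FormallyUnramified φ] [LocallyOfFiniteType φ]

/-- The stalk maps of a flat, unramified, locally finite-type morphism (e.g. an étale morphism)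
are étale local homomorphisms, which **preserve `𝔪`-adic orders of ideals**:
`I · 𝒪_{X',x'} ⊆ 𝔪_{x'}^k ↔ I ⊆ 𝔪_{φ x'}^k` (`map_le_maximalIdeal_pow_iff`: faithful flatness and
`𝔪_{φ x'} 𝒪_{X',x'} = 𝔪_{x'}`, Stacks 00UW). [cite: StacksProject, Tag 00UW] -/
theorem map_stalkMap_le_maximalIdeal_pow_iff (x' : X') (I : Ideal (X.presheaf.stalk (φ x')))
    (k : ℕ) :
    I.map (φ.stalkMap x').hom ≤ maximalIdeal (X'.presheaf.stalk x') ^ k ↔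
      I ≤ maximalIdeal (X.presheaf.stalk (φ x')) ^ k := by
  algebraize [(φ.stalkMap x').hom]
  haveI : IsLocalHom (algebraMap (X.presheaf.stalk (φ x')) (X'.presheaf.stalk x')) :=
    inferInstanceAs <| IsLocalHom (φ.stalkMap x').hom
  haveI : Module.Flat (X.presheaf.stalk (φ x')) (X'.presheaf.stalk x') := Flat.stalkMap φ x'
  haveI : Algebra.EssFiniteType (X.presheaf.stalk (φ x')) (X'.presheaf.stalk x') := by
    rw [← RingHom.essFiniteType_algebraMap, RingHom.algebraMap_toAlgebra]
    exact LocallyOfFiniteType.stalkMap φ x'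
  haveI : Algebra.FormallyUnramified (X.presheaf.stalk (φ x')) (X'.presheaf.stalk x') := by
    rw [← RingHom.formallyUnramified_algebraMap, RingHom.algebraMap_toAlgebra]
    exact FormallyUnramified.stalkMap φ x'
  exact map_le_maximalIdeal_pow_iff I k

/-- `ord_{x'}(φ^*𝓘) ≥ n ↔ ord_{φ x'}(𝓘) ≥ n` along an étale (flat, unramified, locally
finite-type) morphism. [cite: BierstoneGrigorievMilmanWlodarczyk2011, Lemma 8.0.3 (2)] -/
theorem le_idealOrder_comap_iff (I : X.IdealSheafData) (x' : X') (n : ℕ) :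
    (n : ℕ∞) ≤ idealOrder (I.comap φ) x' ↔ (n : ℕ∞) ≤ idealOrder I (φ x') := by
  rw [le_idealOrder_iff, le_idealOrder_iff, stalkIdeal_comap_eq_map,
    map_stalkMap_le_maximalIdeal_pow_iff]

/-- **"Étale morphisms preserve multiplicities"** (BGMW, proof of Lemma 8.0.3): the order of the
pulled-back ideal sheaf at `x'` is the order of the ideal sheaf at `φ x'`,
`ord_{x'}(φ^*𝓘) = ord_{φ x'}(𝓘)`, for `φ` flat, unramified and locally of finite type.
[cite: BierstoneGrigorievMilmanWlodarczyk2011, Lemma 8.0.3 (2)] -/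
theorem idealOrder_comap_of_etale (I : X.IdealSheafData) (x' : X') :
    idealOrder (I.comap φ) x' = idealOrder I (φ x') :=
  ENat.eq_of_forall_natCast_le_iff fun n => le_idealOrder_comap_iff φ I x' n

/-- **The support of the pulled-back marked ideal is the preimage of the support**:
`supp(φ^*(X, 𝓘, E, μ)) = φ⁻¹ supp(X, 𝓘, E, μ)` for `φ` étale (flat, unramified, locally of
finite type) — the compatibility underlying "the induced sequence `φ^*(X_i)`" being a multiple
blow-up of `φ^*(X, 𝓘, E, μ)` in Thm. 8.0.5.
[cite: BierstoneGrigorievMilmanWlodarczyk2011, Thm. 8.0.5 with Def. 3.1.2] -/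
theorem MarkedIdeal.support_comap_of_etale (M : MarkedIdeal X) (E' : List X'.IdealSheafData) :
    (⟨M.ideal.comap φ, E', M.mult⟩ : MarkedIdeal X').support = φ ⁻¹' M.support := by
  ext x'
  exact le_idealOrder_comap_iff φ M.ideal x' M.mult

end Etale

/-! ## Flat base change of colon ideal sheaves and of the transforms of a marked ideal -/

section Transforms

open Scheme.IdealSheafData

variable {Y' Y : Scheme.{u}} (t : Y' ⟶ Y) [Flat t] [IsLocallyNoetherian Y] [IsLocallyNoetherian Y']

/-- **The colon ideal sheaf commutes with flat base change** between locally Noetherian schemes: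
`(L : M).comap t = (L.comap t : M.comap t)` (sectionwise `ideal_colon`, the chart formula
`ideal_comap_of_le`, and Matsumura Thm. 7.4 (iii) for the flat ring maps
`Γ(Y, U) → Γ(Y', V)`). [cite: Matsumura1987, Thm. 7.4 (iii)] -/
theorem comap_colon_of_flat (L M : Y.IdealSheafData) :
    (colon L M).comap t = colon (L.comap t) (M.comap t) := by
  refine ext_of_iSup_eq_top (fun p : {p : Y'.affineOpens × Y.affineOpens //
      (p.1 : Y'.Opens) ≤ t ⁻¹ᵁ (p.2 : Y.Opens)} => p.1.1)
    (iSup_affineOpens_le_preimage_eq_top t) fun p => ?_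
  obtain ⟨⟨V, U⟩, hVU⟩ := p
  haveI : IsNoetherianRing Γ(Y, U) := IsLocallyNoetherian.component_noetherian U
  have hflat : (t.appLE U V hVU).hom.Flat := HasRingHomProperty.appLE @Flat t inferInstance U V hVU
  algebraize [(t.appLE U V hVU).hom]
  haveI : Module.Flat Γ(Y, U) Γ(Y', V) := hflat
  change ((colon L M).comap t).ideal V = (colon (L.comap t) (M.comap t)).ideal V
  rw [ideal_comap_of_le t _ U V hVU, ideal_colon, ideal_colon, ideal_comap_of_le t _ U V hVU,
    ideal_comap_of_le t _ U V hVU]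
  exact Ideal.map_colon_of_flat (L.ideal U) (M.ideal U) (IsNoetherian.noetherian _)

variable {Z' Z : Scheme.{u}} {π : Z ⟶ Y} {π' : Z' ⟶ Y'} {s : Z' ⟶ Z} [Flat s]
  [IsLocallyNoetherian Z] [IsLocallyNoetherian Z']

omit [Flat t] [IsLocallyNoetherian Y] [IsLocallyNoetherian Y'] in
/-- **Controlled transforms commute with flat base change**: for a commutative square
`s ≫ π = π' ≫ t` with `s` flat (e.g. the cartesian square of the blow-ups of `Y` along `C` and
of `Y'` along `t^*C` over a flat `t`, GW Prop. 13.91), the controlled transform of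
`(t^*𝓘, μ)` under `π'` with respect to the centre `t^*C` is the pull-back along `s` of the
controlled transform of `(𝓘, μ)` under `π`: `s^* (π^*𝓘 : 𝓘(D)^μ) = (π'^* t^*𝓘 : 𝓘(D')^μ)`,
`D' = s⁻¹ D`. [cite: BierstoneGrigorievMilmanWlodarczyk2011, §3.2 with Thm. 8.0.5] -/
theorem comap_controlledTransform_of_flat (hsq : s ≫ π = π' ≫ t) (C I : Y.IdealSheafData)
    (μ : ℕ) :
    (controlledTransform π C I μ).comap s = controlledTransform π' (C.comap t) (I.comap t) μ := by
  rw [controlledTransform, controlledTransform, comap_colon_of_flat, comap_pow, ← comap_comp,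
    ← comap_comp, hsq, comap_comp, comap_comp]

omit [Flat t] [IsLocallyNoetherian Y] [IsLocallyNoetherian Y'] in
/-- **Strict transforms commute with flat base change** (same square):
`s^* (⋃ₙ (π^*K : 𝓘(D)ⁿ)) = ⋃ₙ (π'^* t^*K : 𝓘(D')ⁿ)`. [folklore] -/
theorem comap_strictTransformIdeal_of_flat (hsq : s ≫ π = π' ≫ t) (C K : Y.IdealSheafData) :
    (strictTransformIdeal π C K).comap s = strictTransformIdeal π' (C.comap t) (K.comap t) := by
  rw [strictTransformIdeal, strictTransformIdeal, (map_gc s).l_iSup]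
  congr 1
  funext n
  rw [← controlledTransform, ← controlledTransform, comap_controlledTransform_of_flat t hsq]

omit [Flat t] [IsLocallyNoetherian Y] [IsLocallyNoetherian Y'] in
/-- **The transform of a marked ideal commutes with flat base change** (BGMW Def. 3.1.3 (3)–(5)
for the pulled-back marked ideal of Thm. 8.0.5): for a commutative square `s ≫ π = π' ≫ t` with
`s` flat, the transform of `t^*(Y, 𝓘, E, μ) = (Y', t^*𝓘, t^*E, μ)` under `π'` with centre `t^*C`
is the pull-back along `s` of the transform of `(Y, 𝓘, E, μ)` under `π` with centre `C`
(ideal: controlled transforms; boundary: strict transforms of the old divisors in order, then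
the exceptional divisor `s⁻¹ π⁻¹ V(C) = π'⁻¹ V(t^*C)`).
[cite: BierstoneGrigorievMilmanWlodarczyk2011, Def. 3.1.3 (3)–(5) with Thm. 8.0.5] -/
theorem MarkedIdeal.transform_comap_of_flat (hsq : s ≫ π = π' ≫ t) (M : MarkedIdeal Y)
    (C : Y.IdealSheafData) :
    (⟨M.ideal.comap t, M.boundary.map (·.comap t), M.mult⟩ : MarkedIdeal Y').transform π'
        (C.comap t) =
      ⟨(M.transform π C).ideal.comap s, (M.transform π C).boundary.map (·.comap s), M.mult⟩ := by
  simp only [MarkedIdeal.transform, List.map_append, List.map_map, List.map_cons, List.map_nil,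
    comap_controlledTransform_of_flat t hsq]
  congr 2
  · refine List.map_congr_left fun D _ => ?_
    simp only [Function.comp_apply, comap_strictTransformIdeal_of_flat t hsq]
  · rw [← comap_comp, ← comap_comp, hsq]

end Transforms

/-! ## Regular centres under étale base change -/

section Regular

variable {X' X : Scheme.{u}} (φ : X' ⟶ X) [Flat φ] [FormallyUnramified φ] [LocallyOfFiniteType φ]

/-- Along a flat, unramified, locally finite-type morphism of locally Noetherian schemes the local
ring at `x'` is regular iff the local ring at `φ x'` is (étale local homomorphisms preserve and
reflect regularity, Matsumura Thm. 23.7; `isRegularLocalRing_iff_of_etaleLocal`).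
[cite: Matsumura1987, Thm. 23.7] -/
theorem isRegularLocalRing_stalk_iff_of_etale [IsLocallyNoetherian X] [IsLocallyNoetherian X']
    (x' : X') :
    IsRegularLocalRing (X'.presheaf.stalk x') ↔ IsRegularLocalRing (X.presheaf.stalk (φ x')) := by
  algebraize [(φ.stalkMap x').hom]
  haveI : IsLocalHom (algebraMap (X.presheaf.stalk (φ x')) (X'.presheaf.stalk x')) :=
    inferInstanceAs <| IsLocalHom (φ.stalkMap x').hom
  haveI : Module.Flat (X.presheaf.stalk (φ x')) (X'.presheaf.stalk x') := Flat.stalkMap φ x'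
  haveI : Algebra.EssFiniteType (X.presheaf.stalk (φ x')) (X'.presheaf.stalk x') := by
    rw [← RingHom.essFiniteType_algebraMap, RingHom.algebraMap_toAlgebra]
    exact LocallyOfFiniteType.stalkMap φ x'
  haveI : Algebra.FormallyUnramified (X.presheaf.stalk (φ x')) (X'.presheaf.stalk x') := by
    rw [← RingHom.formallyUnramified_algebraMap, RingHom.algebraMap_toAlgebra]
    exact FormallyUnramified.stalkMap φ x'
  exact isRegularLocalRing_iff_of_etaleLocal (X.presheaf.stalk (φ x')) (X'.presheaf.stalk x')

omit [Flat φ] [FormallyUnramified φ] [LocallyOfFiniteType φ] in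
/-- **A scheme flat, unramified and locally of finite type (e.g. étale) over a regular locally
Noetherian scheme is regular.** [cite: Matsumura1987, Thm. 23.7] -/
theorem Scheme.IsRegular.of_flat_of_formallyUnramified [Flat φ] [FormallyUnramified φ]
    [LocallyOfFiniteType φ] [IsLocallyNoetherian X] (hX : Scheme.IsRegular X) :
    Scheme.IsRegular X' := by
  haveI : IsLocallyNoetherian X' := LocallyOfFiniteType.isLocallyNoetherian φ
  intro x'
  exact (isRegularLocalRing_stalk_iff_of_etale φ x').mpr (hX (φ x'))

/-- **Regular centres pull back to regular centres along étale morphisms**: if the closed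
subscheme `V(C) ⊆ X` is regular and `φ : X' → X` is étale (flat, unramified, locally of finite
type), `X` locally Noetherian, then `V(φ^*C) = V(C) ×_X X' ⊆ X'` is regular — the condition
"smooth centres" of BGMW Def. 3.1.3 [rendered: regular centres] for the induced sequence
`φ^*(X_i)` of Thm. 8.0.5. [cite: BierstoneGrigorievMilmanWlodarczyk2011, Thm. 8.0.5 with Def. 3.1.3] -/
theorem Scheme.IsRegular.subscheme_comap_of_etale [IsLocallyNoetherian X] (C : X.IdealSheafData)
    (hC : Scheme.IsRegular C.subscheme) : Scheme.IsRegular (C.comap φ).subscheme := by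
  haveI : IsLocallyNoetherian C.subscheme := LocallyOfFiniteType.isLocallyNoetherian C.subschemeι
  haveI : Flat (pullback.snd φ C.subschemeι) := MorphismProperty.pullback_snd _ _ inferInstance
  haveI : FormallyUnramified (pullback.snd φ C.subschemeι) :=
    MorphismProperty.pullback_snd _ _ inferInstance
  haveI : LocallyOfFiniteType (pullback.snd φ C.subschemeι) :=
    MorphismProperty.pullback_snd _ _ inferInstance
  have hP : Scheme.IsRegular (pullback φ C.subschemeι) :=
    Scheme.IsRegular.of_flat_of_formallyUnramified (pullback.snd φ C.subschemeι) hC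
  exact hP.of_iso (C.comapIso φ).inv

end Regular

/-! ## Simple normal crossings under étale pull-back -/

section SNC

variable {X' X : Scheme.{u}} (φ : X' ⟶ X) [FormallyUnramified φ] [LocallyOfFiniteType φ]

/-- The stalk maps of an unramified, locally finite-type morphism map the maximal ideal onto the
maximal ideal: `𝔪_{φ x'} · 𝒪_{X',x'} = 𝔪_{x'}` (Stacks 00UW). [cite: StacksProject, Tag 00UW] -/
theorem map_stalkMap_maximalIdeal (x' : X') :
    (maximalIdeal (X.presheaf.stalk (φ x'))).map (φ.stalkMap x').hom =
      maximalIdeal (X'.presheaf.stalk x') := by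
  algebraize [(φ.stalkMap x').hom]
  haveI : IsLocalHom (algebraMap (X.presheaf.stalk (φ x')) (X'.presheaf.stalk x')) :=
    inferInstanceAs <| IsLocalHom (φ.stalkMap x').hom
  haveI : Algebra.EssFiniteType (X.presheaf.stalk (φ x')) (X'.presheaf.stalk x') := by
    rw [← RingHom.essFiniteType_algebraMap, RingHom.algebraMap_toAlgebra]
    exact LocallyOfFiniteType.stalkMap φ x'
  haveI : Algebra.FormallyUnramified (X.presheaf.stalk (φ x')) (X'.presheaf.stalk x') := by
    rw [← RingHom.formallyUnramified_algebraMap, RingHom.algebraMap_toAlgebra]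
    exact FormallyUnramified.stalkMap φ x'
  exact Algebra.FormallyUnramified.map_maximalIdeal

variable [Flat φ]

/-- `dim 𝒪_{X',x'} = dim 𝒪_{X,φ x'}` along a flat, unramified, locally finite-type morphism of
locally Noetherian schemes (Matsumura Thm. 15.1 with the closed fibre a field;
`ringKrullDim_eq_of_etaleLocal`). [cite: Matsumura1987, Thm. 15.1] -/
theorem ringKrullDim_stalk_eq_of_etale [IsLocallyNoetherian X] [IsLocallyNoetherian X'] (x' : X') :
    ringKrullDim (X'.presheaf.stalk x') = ringKrullDim (X.presheaf.stalk (φ x')) := by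
  algebraize [(φ.stalkMap x').hom]
  haveI : IsLocalHom (algebraMap (X.presheaf.stalk (φ x')) (X'.presheaf.stalk x')) :=
    inferInstanceAs <| IsLocalHom (φ.stalkMap x').hom
  haveI : Module.Flat (X.presheaf.stalk (φ x')) (X'.presheaf.stalk x') := Flat.stalkMap φ x'
  haveI : Algebra.EssFiniteType (X.presheaf.stalk (φ x')) (X'.presheaf.stalk x') := by
    rw [← RingHom.essFiniteType_algebraMap, RingHom.algebraMap_toAlgebra]
    exact LocallyOfFiniteType.stalkMap φ x'
  haveI : Algebra.FormallyUnramified (X.presheaf.stalk (φ x')) (X'.presheaf.stalk x') := by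
    rw [← RingHom.formallyUnramified_algebraMap, RingHom.algebraMap_toAlgebra]
    exact FormallyUnramified.stalkMap φ x'
  exact ringKrullDim_eq_of_etaleLocal (X.presheaf.stalk (φ x')) (X'.presheaf.stalk x')

/-- **Simple normal crossings pull back along étale morphisms** (the conditions of BGMW
Def. 3.1.1 on `E` and Def. 3.1.3 (2) on the centre, `HasSNCWith`, for the pulled-back marked
ideal `φ^*(X, 𝓘, E, μ)` and centre `φ^*C` of Thm. 8.0.5): a regular system of parameters
`u₁, …, u_d` of `𝒪_{X, φ x'}` adapted to `E` and `C` maps to a regular system of parameters of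
`𝒪_{X', x'}` (`𝔪_{φ x'} 𝒪_{X',x'} = 𝔪_{x'}`, `dim 𝒪_{X',x'} = dim 𝒪_{X,φ x'} = d`, both rings
regular) adapted to `φ^*E` and `φ^*C` (stalks of pulled-back ideal sheaves are extended stalks,
`stalkIdeal_comap_eq_map`). [cite: BierstoneGrigorievMilmanWlodarczyk2011, Thm. 8.0.5 with Def. 3.1.3 (2)] -/
theorem HasSNCWith.comap_of_etale [IsLocallyNoetherian X] {E : List X.IdealSheafData}
    {C : X.IdealSheafData} (h : HasSNCWith E C) :
    HasSNCWith (E.map (·.comap φ)) (C.comap φ) := by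
  classical
  haveI : IsLocallyNoetherian X' := LocallyOfFiniteType.isLocallyNoetherian φ
  intro x'
  obtain ⟨hreg, u, hu, ⟨ι, hι, hιD⟩, hC⟩ := h (φ x')
  haveI := hreg
  haveI hreg' : IsRegularLocalRing (X'.presheaf.stalk x') :=
    (isRegularLocalRing_stalk_iff_of_etale φ x').mpr hreg
  refine ⟨hreg', ?_⟩
  set f := (φ.stalkMap x').hom with hf
  -- the embedding dimensions agree
  have hrank : (maximalIdeal (X'.presheaf.stalk x')).spanFinrank =
      (maximalIdeal (X.presheaf.stalk (φ x'))).spanFinrank := by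
    have h1 := hreg'.spanFinrank_maximalIdeal
    have h2 := hreg.spanFinrank_maximalIdeal
    rw [ringKrullDim_stalk_eq_of_etale φ x', ← h2] at h1
    exact_mod_cast h1
  let σ : Fin (maximalIdeal (X'.presheaf.stalk x')).spanFinrank ≃
      Fin (maximalIdeal (X.presheaf.stalk (φ x'))).spanFinrank := finCongr hrank
  let u' : Fin (maximalIdeal (X'.presheaf.stalk x')).spanFinrank → X'.presheaf.stalk x' :=
    fun i => f (u (σ i))
  have hu'σ : ∀ j, u' (σ.symm j) = f (u j) := fun j => by
    simp only [u', Equiv.apply_symm_apply]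
  refine ⟨u', ?_, ?_, ?_⟩
  · -- `(u') = 𝔪_{x'}`
    have hr : Set.range u' = f '' Set.range u := by
      rw [show u' = (fun j => f (u j)) ∘ σ from rfl, σ.surjective.range_comp]
      exact Set.range_comp f u
    rw [hr, ← Ideal.map_span, hu, hf, map_stalkMap_maximalIdeal]
  · -- the boundary components through `x'`
    have key : ∀ D' : {D' // D' ∈ E.map (·.comap φ) ∧ x' ∈ D'.support},
        ∃ D : {D // D ∈ E ∧ φ x' ∈ D.support}, D.1.comap φ = D'.1 := by
      rintro ⟨D', hD'E, hx'⟩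
      obtain ⟨D, hDE, rfl⟩ := List.mem_map.mp hD'E
      refine ⟨⟨D, hDE, ?_⟩, rfl⟩
      rw [Scheme.IdealSheafData.support_comap] at hx'
      exact hx'
    choose g hg using key
    refine ⟨fun D' => σ.symm (ι (g D')), ?_, ?_⟩
    · intro D₁ D₂ heq
      have h2 : g D₁ = g D₂ := hι (σ.symm.injective heq)
      apply Subtype.ext
      rw [← hg D₁, ← hg D₂, h2]
    · intro D'
      rw [hu'σ, ← hg D', stalkIdeal_comap_eq_map, hιD (g D'), Ideal.map_span, Set.image_singleton]
  · -- the centre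
    intro hx'
    rw [Scheme.IdealSheafData.support_comap] at hx'
    obtain ⟨S, hS⟩ := hC hx'
    refine ⟨σ ⁻¹' S, ?_⟩
    rw [stalkIdeal_comap_eq_map, hS, Ideal.map_span, Set.image_image]
    congr 1
    rw [show u' = (fun j => f (u j)) ∘ σ from rfl, Set.image_comp, σ.image_preimage]

end SNC

/-! ## Étale pull-back of multiple blow-ups and of resolutions of marked ideals (Thm. 8.0.5) -/

section MultipleBlowup

variable {X' X : Scheme.{u}} (φ : X' ⟶ X) [Flat φ] [FormallyUnramified φ] [LocallyOfFiniteType φ]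
  [IsLocallyNoetherian X]

/-- **The induced sequence `φ^*(X_i)` of a multiple blow-up is a multiple blow-up of the
pulled-back marked ideal** (BGMW Thm. 8.0.5 (1)–(2), the statement implicit in "the induced
sequence `(X'_i) = φ^*(X_i)` is [an extension of] the canonical resolution of
`φ^*(X, 𝓘, E, μ)`"), for `φ` flat, unramified and locally of finite type (e.g. étale) and `X`
locally Noetherian: if `σ : Z → X` is a multiple blow-up of `(X, 𝓘, E, μ)` with final marked ideal
`(Z, 𝓘_r, E_r, μ)`, then the fibre product `Z' = Z ×_X X' → X'` — built step by step from the
blow-ups `Bl_{ψᵢ^*Cᵢ} = Bl_{Cᵢ} ×_{Xᵢ} X'ᵢ` (blow-ups commute with flat base change, GW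
Prop. 13.91) — is a multiple blow-up of `φ^*(X, 𝓘, E, μ) = (X', φ^*𝓘, φ^*E, μ)` with final marked
ideal `ψ^*(Z, 𝓘_r, E_r, μ)`, `ψ : Z' → Z` the (flat, unramified, locally finite-type) projection:
the pulled-back centres are regular (`Scheme.IsRegular.subscheme_comap_of_etale`), lie in the
support (`MarkedIdeal.support_comap_of_etale`), have simple normal crossings with the pulled-back
boundary (`HasSNCWith.comap_of_etale`), and the transforms are the pulled-back transforms
(`MarkedIdeal.transform_comap_of_flat`).
[cite: BierstoneGrigorievMilmanWlodarczyk2011, Thm. 8.0.5 (1)–(2) with Def. 3.1.3] -/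
theorem IsMultipleBlowup.exists_isPullback_of_etale {M : MarkedIdeal X} {Z : Scheme.{u}}
    {σ : Z ⟶ X} {N : MarkedIdeal Z} (h : IsMultipleBlowup M σ N) :
    ∃ (Z' : Scheme.{u}) (σ' : Z' ⟶ X') (ψ : Z' ⟶ Z), IsPullback ψ σ' σ φ ∧ Flat ψ ∧
      FormallyUnramified ψ ∧ LocallyOfFiniteType ψ ∧
      IsMultipleBlowup (⟨M.ideal.comap φ, M.boundary.map (·.comap φ), M.mult⟩ : MarkedIdeal X') σ'
        ⟨N.ideal.comap ψ, N.boundary.map (·.comap ψ), N.mult⟩ := by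
  induction h with
  | refl =>
    refine ⟨X', 𝟙 X', φ, IsPullback.of_vert_isIso ⟨by simp⟩, inferInstance, inferInstance,
      inferInstance, ?_⟩
    exact IsMultipleBlowup.refl _
  | @blowup Z₀ Z₁ σ₀ N₀ h₀ C τ hτ hC hsupp hsnc ih =>
    obtain ⟨Z₀', σ₀', ψ₀, hpb₀, hfl, hur, hft, hmb⟩ := ih
    haveI := hfl
    haveI := hur
    haveI := hft
    haveI : IsLocallyNoetherian Z₀ := h₀.isLocallyNoetherian
    haveI : IsLocallyNoetherian Z₁ := (h₀.blowup C τ hτ hC hsupp hsnc).isLocallyNoetherian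
    haveI : IsLocallyNoetherian Z₀' := LocallyOfFiniteType.isLocallyNoetherian ψ₀
    -- the next stage `Z₁' = Z₁ ×_{Z₀} Z₀' = Bl_{ψ₀^* C}(Z₀')`
    haveI : Flat (pullback.fst τ ψ₀) := MorphismProperty.pullback_fst _ _ hfl
    haveI : FormallyUnramified (pullback.fst τ ψ₀) := MorphismProperty.pullback_fst _ _ hur
    haveI : LocallyOfFiniteType (pullback.fst τ ψ₀) := MorphismProperty.pullback_fst _ _ hft
    haveI : IsLocallyNoetherian (pullback τ ψ₀) :=
      LocallyOfFiniteType.isLocallyNoetherian (pullback.fst τ ψ₀)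
    have hτ' : IsBlowup (pullback.snd τ ψ₀) (C.comap ψ₀) :=
      hτ.of_isPullback_of_flat (IsPullback.of_hasPullback τ ψ₀)
    refine ⟨pullback τ ψ₀, pullback.snd τ ψ₀ ≫ σ₀', pullback.fst τ ψ₀,
      (IsPullback.of_hasPullback τ ψ₀).paste_vert hpb₀, inferInstance, inferInstance,
      inferInstance, ?_⟩
    have hsupp' : ((C.comap ψ₀).support : Set Z₀') ⊆
        (⟨N₀.ideal.comap ψ₀, N₀.boundary.map (·.comap ψ₀), N₀.mult⟩ : MarkedIdeal Z₀').support := by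
      intro z hz
      rw [Scheme.IdealSheafData.support_comap] at hz
      rw [MarkedIdeal.support_comap_of_etale]
      exact hsupp hz
    have step := hmb.blowup (C.comap ψ₀) (pullback.snd τ ψ₀) hτ'
      (Scheme.IsRegular.subscheme_comap_of_etale ψ₀ C hC) hsupp' (hsnc.comap_of_etale ψ₀)
    rwa [MarkedIdeal.transform_comap_of_flat ψ₀ (pullback.condition (f := τ) (g := ψ₀)) N₀ C]
      at step

/-- **The étale pull-back of a resolution of a marked ideal is a resolution of the pulled-back
marked ideal** (BGMW Thm. 8.0.5 (1)–(2): the induced sequence `φ^*(X_i)` of the canonical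
resolution is a resolution of `φ^*(X, 𝓘, E, μ)`; Def. 3.1.3 (6): the final support
`supp ψ^*(Z, 𝓘_r, E_r, μ) = ψ⁻¹ supp(Z, 𝓘_r, E_r, μ) = ∅`).
[cite: BierstoneGrigorievMilmanWlodarczyk2011, Thm. 8.0.5 (1)–(2) with Def. 3.1.3] -/
theorem IsMarkedResolution.exists_isPullback_of_etale {M : MarkedIdeal X} {Z : Scheme.{u}}
    {σ : Z ⟶ X} {N : MarkedIdeal Z} (h : IsMarkedResolution M σ N) :
    ∃ (Z' : Scheme.{u}) (σ' : Z' ⟶ X') (ψ : Z' ⟶ Z), IsPullback ψ σ' σ φ ∧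
      IsMarkedResolution (⟨M.ideal.comap φ, M.boundary.map (·.comap φ), M.mult⟩ : MarkedIdeal X')
        σ' ⟨N.ideal.comap ψ, N.boundary.map (·.comap ψ), N.mult⟩ := by
  obtain ⟨Z', σ', ψ, hpb, hfl, hur, hft, hmb⟩ := h.1.exists_isPullback_of_etale φ
  refine ⟨Z', σ', ψ, hpb, hmb, ?_⟩
  haveI := hfl
  haveI := hur
  haveI := hft
  rw [MarkedIdeal.support_comap_of_etale, h.2, Set.preimage_empty]

end MultipleBlowup

end Literature.AlgebraicGeometry.Resolution
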